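import Mathlib
import HarnessLib
import Summits.Ventures.LatticeQCDFlow.Exactness.IMHModeHolding
import Summits.Ventures.LatticeQCDFlow.Scaling.AutoregressiveGaugeAllClosingScorecard
import Summits.Ventures.LatticeQCDFlow.Scaling.PlaquetteManyWeightConstant

/-!
# LatticeQCDFlow / Scaling — the cold start of the all-closing-plaquettes exact sampler, EXACTLY: acceptance
# mass `Z/∏_ℓ c_{#C_ℓ}` at the cold configuration, the geometric law, and the comparison with the one-plaquette
# heat bath (never slower at cold; `η⁻¹` times faster along the same structure)

HONEST FRAMING: exact (Metropolis-corrected) sampling algorithms for lattice gauge theory;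
figures of merit are autocorrelation/cost numbers at stated couplings and volumes; no
continuum-physics claim.

Venture `LatticeQCDFlow` (cell pub-lqcd), topic `Scaling`, FANOUT row 30 (lean-1, GEN-28) — OUR WORK on
THEORY-2.md §4 row C5 (gen27 NEXT (2): «a floor for the all-closing sampler at the cold configuration»).
`AutoregressiveGaugeAllClosingHeatBath` ∕ `…Scorecard` built the all-closing-plaquettes conditioner along a
closing assignment `(T, C)` (link `ℓ ∈ T` scores every plaquette of `C_ℓ`, normaliser `N_ℓ(U) ≤ c_{#C_ℓ}`) and
its exact sampler `K = indepMH q (∏_ℓ N_ℓ/Z)` with a Doeblin CEILING.  Here its cold start, exactly, with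
`Exactness/IMHModeHolding`:

* §1 **`normaliser_cold_eq`** — at `U ≡ 1` a redrawn link gives `U[ℓ ↦ v]_p = v^{±1}` (`p ∋ ℓ`), so for an
  inversion-symmetric weight (`w(g⁻¹) = w(g)`, Wilson weights) `N_ℓ(cold) = ∫ w^{#C_ℓ} dHaar = c_{#C_ℓ}`: the
  cold configuration MAXIMISES every normaliser, i.e. it is the mode of the importance weight `∏_ℓ N_ℓ/Z`;
* §2 **`allClosing_cold_acceptMass_eq`** — the acceptance mass at cold is EXACTLY `Z/∏_{ℓ∈T} c_{#C_ℓ}`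
  (`Z = ∫ ∏_p w(U_p)`); **`allClosing_coldStart_eq`** — with atom-free Haar, `(K^t δ_cold)({cold}) =
  (1 − Z/∏_ℓ c_{#C_ℓ})^t` EXACTLY;
* §3 COMPARISON with the one-plaquette heat bath, whose exact cold rate is `Z/(c^{#B} M^k)`
  (`AutoregressiveGaugeHeatBathColdExact`): **`prod_integral_pow_card_le`** `∏_{ℓ∈T} c_{#C_ℓ} ≤
  c^{#T}·M^{Σ_ℓ(#C_ℓ − 1)}` (`c_{n+1} ≤ M^n c`), **`sum_card_closing_eq`** `Σ_ℓ #C_ℓ = #P` for a partition, hence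
  (**`heatBath_coldRate_le_allClosing`**) for every closing assignment with `#T = #B` closing links — e.g. the
  all-closing assignment along the order of an OPTIMAL structure (`AutoregressiveGaugeAllClosingOptimalOrder`,
  `#T = (d−1)(L^d − 1) = #B`) — the heat-bath cold escape rate is AT MOST the all-closing one:
  `Z/(c^{#B} M^{#Bᶜ}) ≤ Z/∏_ℓ c_{#C_ℓ}`.  The ratio `∏_ℓ c_{#C_ℓ}/(c^{#B} M^k) = ∏_ℓ θ_{#C_ℓ − 1}`
  (`θ_n = c_{n+1}/(c M^n) ≤ 1`) is, for the assignment INDUCED by a total closing map `u`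
  (`C_{t(a)} = {a} ∪ u⁻¹(a)`), exactly GEN-27's `η = ∏_{a∈B} θ_{n_a}` of `…ClosingMapFloor`: at the cold start the
  all-closing sampler moves EXACTLY `η⁻¹` times more often than the one-plaquette heat bath.

NOT CLAIMED: anything away from the cold configuration; in particular no floor on the all-closing sampler's
autocorrelation time follows (that needs the normalisers' deficit `N_ℓ < c_{#C_ℓ}` under the proposal, open).
No `def`, no `sorry`, nothing cited as a fact beyond the tree.
-/

noncomputable section

namespace Summit.Ventures.LatticeQCDFlow.Theory2.Autoregressive

open MeasureTheory ProbabilityTheory Function Finset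
open scoped ENNReal
open Literature.MathematicalPhysics.QuantumFieldTheory Literature.MathematicalPhysics.QuantumLattice
open Summit.Ventures.LatticeQCDFlow.Exactness Summit.Ventures.LatticeQCDFlow.Scoring

variable {d L : ℕ} [NeZero L] {G : Type*} [Group G] [TopologicalSpace G] [IsTopologicalGroup G]
  [CompactSpace G] [SecondCountableTopology G] [MeasurableSpace G] [BorelSpace G]

/-! ## §1 The all-closing normaliser at the cold configuration -/

omit [TopologicalSpace G] [IsTopologicalGroup G] [CompactSpace G] [SecondCountableTopology G] [MeasurableSpace G]
  [BorelSpace G] in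
/-- At the cold configuration, redrawing a link `ℓ` of `p` gives `w(U[ℓ ↦ v]_p) = w(v)` for an
inversion-symmetric weight (`U[ℓ ↦ v]_p = v` or `v⁻¹` according to the position of `ℓ` on `p`). [ours] -/
theorem weight_plaquetteHolonomy_update_cold (hL : 2 ≤ L) {w : G → ℝ} (hwinv : ∀ g, w g⁻¹ = w g)
    (ℓ : Edge d L) (v : G) (p : Plaquette d L)
    (hℓ : ℓ ∈ ({(p.1, p.2.1.1), (p.1.shift p.2.1.1, p.2.1.2), (p.1.shift p.2.1.2, p.2.1.1), (p.1, p.2.1.2)} :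
      Finset (Edge d L))) :
    w (plaquetteHolonomy (update (fun _ : Edge d L => (1 : G)) ℓ v) p.1 p.2.1.1 p.2.1.2) = w v := by
  have hij : p.2.1.1 ≠ p.2.1.2 := ne_of_lt p.2.2
  simp only [Finset.mem_insert, Finset.mem_singleton] at hℓ
  rcases hℓ with rfl | rfl | rfl | rfl
  · rw [plaquetteHolonomy_update_first hL _ p.1 hij]; simp
  · rw [plaquetteHolonomy_update_second hL _ p.1 hij]; simp
  · rw [plaquetteHolonomy_update_third hL _ p.1 hij]; simp [hwinv]
  · rw [plaquetteHolonomy_update_fourth hL _ p.1 hij]; simp [hwinv]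

omit [SecondCountableTopology G] in
/-- **The all-closing normaliser at cold is `c_{#C}`**: `∫ ∏_{p∈C} w(cold[ℓ ↦ v]_p) dHaar(v) = ∫ w^{#C} dHaar`
when every `p ∈ C` contains `ℓ` and `w(g⁻¹) = w(g)`. [ours] -/
theorem normaliser_cold_eq (hL : 2 ≤ L) {w : G → ℝ} (hwinv : ∀ g, w g⁻¹ = w g) (C : Finset (Plaquette d L))
    (ℓ : Edge d L)
    (hC : ∀ p ∈ C, ℓ ∈ ({(p.1, p.2.1.1), (p.1.shift p.2.1.1, p.2.1.2), (p.1.shift p.2.1.2, p.2.1.1),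
      (p.1, p.2.1.2)} : Finset (Edge d L))) :
    ∫ v, ∏ p ∈ C, w (plaquetteHolonomy (update (fun _ : Edge d L => (1 : G)) ℓ v) p.1 p.2.1.1 p.2.1.2)
        ∂(haarProbability G) = ∫ h, w h ^ C.card ∂(haarProbability G) := by
  refine integral_congr_ae (ae_of_all _ fun v => ?_)
  simp only
  rw [Finset.prod_congr rfl fun p hp => weight_plaquetteHolonomy_update_cold hL hwinv ℓ v p (hC p hp),
    Finset.prod_const]

/-! ## §2 The all-closing sampler at the cold configuration -/

/-- **ALL-CLOSING CONDITIONER: THE COLD ACCEPTANCE MASS IS EXACTLY `Z/∏_{ℓ∈T} c_{#C_ℓ}`.**  `L ≥ 2`; `w` continuous,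
`0 < m ≤ w ≤ M`, `w(g⁻¹) = w(g)`; `(T, C)` a closing assignment partitioning the plaquettes; target
`π = (F/Z)·Haar^{⊗E}`, proposal `q = ∏_ℓ (∏_{p∈C_ℓ} w(U_p)/N_ℓ(U))·Haar^{⊗E}`, exact sampler
`K = indepMH q (∏_ℓ N_ℓ/Z)`.  (Also recorded: `q = ρ·π` with `ρ = Z/∏_ℓ N_ℓ`, cold maximises `ρ⁻¹`, `ρ`
measurable and positive.) [ours] -/
theorem allClosing_cold_acceptMass_eq (hL : 2 ≤ L) {w : G → ℝ} (hw : Continuous w) {m M : ℝ} (hm0 : 0 < m)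
    (hm : ∀ g, m ≤ w g) (hM : ∀ g, w g ≤ M) (hwinv : ∀ g, w g⁻¹ = w g)
    (T : Finset (Edge d L)) (C : Edge d L → Finset (Plaquette d L))
    (hCne : ∀ ℓ ∈ T, (C ℓ).Nonempty)
    (hCe : ∀ ℓ ∈ T, ∀ p ∈ C ℓ, ℓ ∈ ({(p.1, p.2.1.1), (p.1.shift p.2.1.1, p.2.1.2),
        (p.1.shift p.2.1.2, p.2.1.1), (p.1, p.2.1.2)} : Finset (Edge d L)))
    (hdisj : ∀ ℓ ∈ T, ∀ ℓ' ∈ T, ℓ ≠ ℓ' → Disjoint (C ℓ) (C ℓ'))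
    (hcover : ∀ p : Plaquette d L, ∃ ℓ ∈ T, p ∈ C ℓ)
    (π q : Measure (GaugeConfig d L G)) [IsProbabilityMeasure π] [IsProbabilityMeasure q]
    (hπ : π = (Measure.pi fun _ : Edge d L => haarProbability G).withDensity fun U =>
      ENNReal.ofReal ((∏ p : Plaquette d L, w (plaquetteHolonomy U p.1 p.2.1.1 p.2.1.2)) /
        ∫ V, ∏ p : Plaquette d L, w (plaquetteHolonomy V p.1 p.2.1.1 p.2.1.2) ∂(Measure.pi fun _ : Edge d L => haarProbability G)))
    (hq : q = (Measure.pi fun _ : Edge d L => haarProbability G).withDensity fun U =>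
      ENNReal.ofReal (∏ ℓ ∈ T, (∏ p ∈ C ℓ, w (plaquetteHolonomy U p.1 p.2.1.1 p.2.1.2)) /
          (∫ v, ∏ p ∈ C ℓ, w (plaquetteHolonomy (update U ℓ v) p.1 p.2.1.1 p.2.1.2) ∂(haarProbability G)))) :
    (imhAcceptMass q (fun U => (((∫ V, ∏ p : Plaquette d L, w (plaquetteHolonomy V p.1 p.2.1.1 p.2.1.2) ∂(Measure.pi fun _ : Edge d L => haarProbability G)) /
          ∏ ℓ ∈ T, (∫ v, ∏ p ∈ C ℓ, w (plaquetteHolonomy (update U ℓ v) p.1 p.2.1.1 p.2.1.2) ∂(haarProbability G))))⁻¹)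
        (fun _ : Edge d L => (1 : G))).toReal =
      (∫ V, ∏ p : Plaquette d L, w (plaquetteHolonomy V p.1 p.2.1.1 p.2.1.2) ∂(Measure.pi fun _ : Edge d L => haarProbability G)) /
        ∏ ℓ ∈ T, ∫ h, w h ^ (C ℓ).card ∂(haarProbability G) ∧
      (q = π.withDensity fun U => ENNReal.ofReal
        ((∫ V, ∏ p : Plaquette d L, w (plaquetteHolonomy V p.1 p.2.1.1 p.2.1.2) ∂(Measure.pi fun _ : Edge d L => haarProbability G)) /
          ∏ ℓ ∈ T, (∫ v, ∏ p ∈ C ℓ, w (plaquetteHolonomy (update U ℓ v) p.1 p.2.1.1 p.2.1.2) ∂(haarProbability G)))) ∧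
      (∀ U : GaugeConfig d L G,
        (((∫ V, ∏ p : Plaquette d L, w (plaquetteHolonomy V p.1 p.2.1.1 p.2.1.2) ∂(Measure.pi fun _ : Edge d L => haarProbability G)) /
          ∏ ℓ ∈ T, (∫ v, ∏ p ∈ C ℓ, w (plaquetteHolonomy (update U ℓ v) p.1 p.2.1.1 p.2.1.2) ∂(haarProbability G))))⁻¹ ≤
        (((∫ V, ∏ p : Plaquette d L, w (plaquetteHolonomy V p.1 p.2.1.1 p.2.1.2) ∂(Measure.pi fun _ : Edge d L => haarProbability G)) /
          ∏ ℓ ∈ T, (∫ v, ∏ p ∈ C ℓ, w (plaquetteHolonomy (update (fun _ : Edge d L => (1 : G)) ℓ v) p.1 p.2.1.1 p.2.1.2)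
            ∂(haarProbability G))))⁻¹) ∧
      (Measurable fun U : GaugeConfig d L G =>
        (∫ V, ∏ p : Plaquette d L, w (plaquetteHolonomy V p.1 p.2.1.1 p.2.1.2) ∂(Measure.pi fun _ : Edge d L => haarProbability G)) /
          ∏ ℓ ∈ T, (∫ v, ∏ p ∈ C ℓ, w (plaquetteHolonomy (update U ℓ v) p.1 p.2.1.1 p.2.1.2) ∂(haarProbability G))) ∧
      (∀ U : GaugeConfig d L G, 0 <
        (∫ V, ∏ p : Plaquette d L, w (plaquetteHolonomy V p.1 p.2.1.1 p.2.1.2) ∂(Measure.pi fun _ : Edge d L => haarProbability G)) /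
          ∏ ℓ ∈ T, (∫ v, ∏ p ∈ C ℓ, w (plaquetteHolonomy (update U ℓ v) p.1 p.2.1.1 p.2.1.2) ∂(haarProbability G))) := by
  set Haar : Measure (GaugeConfig d L G) := (Measure.pi fun _ : Edge d L => haarProbability G) with hHaar
  set FT : GaugeConfig d L G → ℝ := fun U => ∏ p : Plaquette d L, w (plaquetteHolonomy U p.1 p.2.1.1 p.2.1.2) with hFT
  set NP : GaugeConfig d L G → ℝ := fun U => ∏ ℓ ∈ T, (∫ v, ∏ p ∈ C ℓ, w (plaquetteHolonomy (update U ℓ v) p.1 p.2.1.1 p.2.1.2) ∂(haarProbability G)) with hNP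
  set ZT : ℝ := ∫ V, FT V ∂Haar with hZT
  set cold : GaugeConfig d L G := fun _ => (1 : G) with hcold
  have hw0 : ∀ g, 0 < w g := fun g => hm0.trans_le (hm g)
  have hc : 0 < ∫ g, w g ∂(haarProbability G) := haarProbability_integral_pos_of_continuous_pos hw hw0
  haveI : IsProbabilityMeasure Haar := by rw [hHaar]; infer_instance
  have hFTc : Continuous FT := continuous_prodPlaquetteWeight_anyDim hw Finset.univ
  have hFTpos : ∀ U, 0 < FT U := fun U => prod_pos fun p _ => hw0 _
  have hFTi : Integrable FT Haar := by
    refine Integrable.mono' (integrable_const (M ^ (Finset.univ : Finset (Plaquette d L)).card))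
      hFTc.aestronglyMeasurable (ae_of_all _ fun U => ?_)
    rw [Real.norm_eq_abs, abs_of_pos (hFTpos U)]
    exact (pow_le_prodPlaquetteWeight_le_pow_anyDim hm0 hm hM _ U).2
  have hZTpos : 0 < ZT := by
    have h := integral_mono (integrable_const (m ^ (Finset.univ : Finset (Plaquette d L)).card)) hFTi
      fun U => (pow_le_prodPlaquetteWeight_le_pow_anyDim hm0 hm hM _ U).1
    rw [integral_const, smul_eq_mul, probReal_univ, one_mul] at h
    exact lt_of_lt_of_le (pow_pos hm0 _) h
  -- the normalisers: squeeze, measurability, and the value at cold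
  have hNlo : ∀ ℓ ∈ T, ∀ U, m ^ ((C ℓ).card - 1) * (∫ g, w g ∂(haarProbability G)) ≤ (∫ v, ∏ p ∈ C ℓ, w (plaquetteHolonomy (update U ℓ v) p.1 p.2.1.1 p.2.1.2) ∂(haarProbability G)) := by
    intro ℓ hℓ U
    obtain ⟨p₀, hp₀⟩ := hCne ℓ hℓ
    exact normaliser_ge hL hw hm0 hm (C ℓ) ℓ hp₀ (hCe ℓ hℓ p₀ hp₀) U
  have hNhi : ∀ ℓ ∈ T, ∀ U, (∫ v, ∏ p ∈ C ℓ, w (plaquetteHolonomy (update U ℓ v) p.1 p.2.1.1 p.2.1.2) ∂(haarProbability G)) ≤ ∫ h, w h ^ (C ℓ).card ∂(haarProbability G) :=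
    fun ℓ hℓ U => integral_update_prod_plaquettes_le hL hw (fun g => (hw0 g).le) U (C ℓ) (hCne ℓ hℓ) (hCe ℓ hℓ)
  have hlopos : ∀ ℓ ∈ T, 0 < m ^ ((C ℓ).card - 1) * (∫ g, w g ∂(haarProbability G)) :=
    fun ℓ _ => mul_pos (pow_pos hm0 _) hc
  have hNPpos : ∀ U, 0 < NP U := fun U =>
    prod_pos fun ℓ hℓ => lt_of_lt_of_le (hlopos ℓ hℓ) (hNlo ℓ hℓ U)
  have hNPm : Measurable NP := Finset.measurable_prod T fun ℓ _ => measurable_normaliser hw (C ℓ) ℓ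
  have hNPhi : ∀ U, NP U ≤ ∏ ℓ ∈ T, ∫ h, w h ^ (C ℓ).card ∂(haarProbability G) := fun U =>
    Finset.prod_le_prod (fun ℓ hℓ => (lt_of_lt_of_le (hlopos ℓ hℓ) (hNlo ℓ hℓ U)).le) fun ℓ hℓ => hNhi ℓ hℓ U
  have hNPcold : NP cold = ∏ ℓ ∈ T, ∫ h, w h ^ (C ℓ).card ∂(haarProbability G) := by
    rw [hNP, hcold]
    exact Finset.prod_congr rfl fun ℓ hℓ => normaliser_cold_eq hL hwinv (C ℓ) ℓ (hCe ℓ hℓ)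
  -- the density ratio `ρ = Z/∏N` : `q = ρ · π`
  set ρ : GaugeConfig d L G → ℝ := fun U => ZT / NP U with hρ
  have hρpos : ∀ U, 0 < ρ U := fun U => div_pos hZTpos (hNPpos U)
  have hρm : Measurable ρ := measurable_const.div hNPm
  have hqdens : ∀ U, (∏ ℓ ∈ T, (∏ p ∈ C ℓ, w (plaquetteHolonomy U p.1 p.2.1.1 p.2.1.2)) /
          (∫ v, ∏ p ∈ C ℓ, w (plaquetteHolonomy (update U ℓ v) p.1 p.2.1.1 p.2.1.2) ∂(haarProbability G))) = FT U / NP U := by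
    intro U
    have h := target_div_allClosing_eq hw hm0 hm hM T C hdisj hcover 1 U
    rw [div_one, div_one] at h
    have hq0 : (∏ ℓ ∈ T, (∏ p ∈ C ℓ, w (plaquetteHolonomy U p.1 p.2.1.1 p.2.1.2)) /
          (∫ v, ∏ p ∈ C ℓ, w (plaquetteHolonomy (update U ℓ v) p.1 p.2.1.1 p.2.1.2) ∂(haarProbability G))) ≠ 0 :=
      (prod_pos fun ℓ hℓ => div_pos (prod_pos fun p _ => hw0 _)
        (lt_of_lt_of_le (hlopos ℓ hℓ) (hNlo ℓ hℓ U))).ne'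
    rw [div_eq_iff hq0] at h
    rw [eq_div_iff (hNPpos U).ne', mul_comm]
    exact h.symm
  have hρq : q = π.withDensity fun U => ENNReal.ofReal (ρ U) := by
    rw [hq, hπ]
    change Haar.withDensity (fun U => ENNReal.ofReal (∏ ℓ ∈ T, (∏ p ∈ C ℓ, w (plaquetteHolonomy U p.1 p.2.1.1 p.2.1.2)) /
          (∫ v, ∏ p ∈ C ℓ, w (plaquetteHolonomy (update U ℓ v) p.1 p.2.1.1 p.2.1.2) ∂(haarProbability G)))) =
      (Haar.withDensity fun U => ENNReal.ofReal (FT U / ZT)).withDensity fun U => ENNReal.ofReal (ρ U)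
    rw [← withDensity_mul _ (by fun_prop : Measurable fun U => ENNReal.ofReal (FT U / ZT))
      (by exact hρm.ennreal_ofReal)]
    refine withDensity_congr_ae (ae_of_all _ fun U => ?_)
    simp only [Pi.mul_apply]
    rw [← ENNReal.ofReal_mul (div_nonneg (hFTpos U).le hZTpos.le), hqdens U]
    congr 1
    rw [hρ]
    field_simp [(hNPpos U).ne', hZTpos.ne']
  -- cold is the mode of the kernel weight `ρ⁻¹`
  have hmax : ∀ U, (ρ U)⁻¹ ≤ (ρ cold)⁻¹ := by
    intro U
    rw [inv_le_inv₀ (hρpos U) (hρpos cold), hρ]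
    show ZT / NP cold ≤ ZT / NP U
    rw [hNPcold]
    exact div_le_div_of_nonneg_left hZTpos.le (hNPpos U) (hNPhi U)
  have hπ' : (q.withDensity fun U => ENNReal.ofReal (ρ U)⁻¹) = π := withDensity_inv_density hρm hρpos hρq
  have hw0' : ∀ U, 0 < (ρ U)⁻¹ := fun U => inv_pos.2 (hρpos U)
  have hone : ∫⁻ y, ENNReal.ofReal (ρ y)⁻¹ ∂q = ENNReal.ofReal 1 := by
    have h : π Set.univ = 1 := measure_univ
    rw [← hπ', withDensity_apply _ MeasurableSet.univ, Measure.restrict_univ] at h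
    rw [h, ENNReal.ofReal_one]
  have hA := imhAcceptMass_toReal_eq_of_forall_le (q := q) hw0' cold hmax zero_le_one hone
  refine ⟨?_, hρq, hmax, hρm, hρpos⟩
  rw [hA, one_div, inv_inv, hρ]
  show ZT / NP cold = ZT / ∏ ℓ ∈ T, ∫ h, w h ^ (C ℓ).card ∂(haarProbability G)
  rw [hNPcold]

/-- **ALL-CLOSING CONDITIONER: THE EXACT COLD-START LAW.**  Same setting, `d ≥ 1`, Haar on `G` without atoms:
`(K^t δ_cold)({cold}) = (1 − Z/∏_{ℓ∈T} c_{#C_ℓ})^t` EXACTLY for every `t`. [ours] -/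
theorem allClosing_coldStart_eq [MeasurableSingletonClass G] [NullSingletonClass (haarProbability G)] (hd : 0 < d)
    (hL : 2 ≤ L) {w : G → ℝ} (hw : Continuous w) {m M : ℝ} (hm0 : 0 < m)
    (hm : ∀ g, m ≤ w g) (hM : ∀ g, w g ≤ M) (hwinv : ∀ g, w g⁻¹ = w g)
    (T : Finset (Edge d L)) (C : Edge d L → Finset (Plaquette d L))
    (hCne : ∀ ℓ ∈ T, (C ℓ).Nonempty)
    (hCe : ∀ ℓ ∈ T, ∀ p ∈ C ℓ, ℓ ∈ ({(p.1, p.2.1.1), (p.1.shift p.2.1.1, p.2.1.2),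
        (p.1.shift p.2.1.2, p.2.1.1), (p.1, p.2.1.2)} : Finset (Edge d L)))
    (hdisj : ∀ ℓ ∈ T, ∀ ℓ' ∈ T, ℓ ≠ ℓ' → Disjoint (C ℓ) (C ℓ'))
    (hcover : ∀ p : Plaquette d L, ∃ ℓ ∈ T, p ∈ C ℓ)
    (π q : Measure (GaugeConfig d L G)) [IsProbabilityMeasure π] [IsProbabilityMeasure q]
    (hπ : π = (Measure.pi fun _ : Edge d L => haarProbability G).withDensity fun U =>
      ENNReal.ofReal ((∏ p : Plaquette d L, w (plaquetteHolonomy U p.1 p.2.1.1 p.2.1.2)) /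
        ∫ V, ∏ p : Plaquette d L, w (plaquetteHolonomy V p.1 p.2.1.1 p.2.1.2) ∂(Measure.pi fun _ : Edge d L => haarProbability G)))
    (hq : q = (Measure.pi fun _ : Edge d L => haarProbability G).withDensity fun U =>
      ENNReal.ofReal (∏ ℓ ∈ T, (∏ p ∈ C ℓ, w (plaquetteHolonomy U p.1 p.2.1.1 p.2.1.2)) /
          (∫ v, ∏ p ∈ C ℓ, w (plaquetteHolonomy (update U ℓ v) p.1 p.2.1.1 p.2.1.2) ∂(haarProbability G))))
    (n : ℕ) :
    ((fun ν : Measure (GaugeConfig d L G) => ν.bind (indepMH q fun U =>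
        (((∫ V, ∏ p : Plaquette d L, w (plaquetteHolonomy V p.1 p.2.1.1 p.2.1.2) ∂(Measure.pi fun _ : Edge d L => haarProbability G)) /
          ∏ ℓ ∈ T, (∫ v, ∏ p ∈ C ℓ, w (plaquetteHolonomy (update U ℓ v) p.1 p.2.1.1 p.2.1.2) ∂(haarProbability G))))⁻¹))^[n]
        (Measure.dirac (fun _ : Edge d L => (1 : G)))).real {fun _ : Edge d L => (1 : G)} =
      (1 - (∫ V, ∏ p : Plaquette d L, w (plaquetteHolonomy V p.1 p.2.1.1 p.2.1.2) ∂(Measure.pi fun _ : Edge d L => haarProbability G)) /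
        ∏ ℓ ∈ T, ∫ h, w h ^ (C ℓ).card ∂(haarProbability G)) ^ n := by
  obtain ⟨hA, hρq, hmax, hρm, hρpos⟩ := allClosing_cold_acceptMass_eq hL hw hm0 hm hM hwinv T C hCne hCe hdisj
    hcover π q hπ hq
  set Haar : Measure (GaugeConfig d L G) := Measure.pi fun _ : Edge d L => haarProbability G with hHaar
  set cold : GaugeConfig d L G := fun _ => (1 : G) with hcold
  set ρ : GaugeConfig d L G → ℝ := fun U =>
    (∫ V, ∏ p : Plaquette d L, w (plaquetteHolonomy V p.1 p.2.1.1 p.2.1.2) ∂(Measure.pi fun _ : Edge d L => haarProbability G)) /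
      ∏ ℓ ∈ T, (∫ v, ∏ p ∈ C ℓ, w (plaquetteHolonomy (update U ℓ v) p.1 p.2.1.1 p.2.1.2) ∂(haarProbability G)) with hρ
  have hwm : Measurable fun U => (ρ U)⁻¹ := hρm.inv
  have hw0' : ∀ U, 0 < (ρ U)⁻¹ := fun U => inv_pos.2 (hρpos U)
  haveI : Nonempty (Edge d L) := ⟨(fun _ => 0, ⟨0, hd⟩)⟩
  have hHaar0 : Haar {cold} = 0 := measure_singleton cold
  have hq0 : q {cold} = 0 := by
    rw [hq]
    exact withDensity_absolutelyContinuous _ _ hHaar0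
  have hπ' : (q.withDensity fun U => ENNReal.ofReal (ρ U)⁻¹) = π := withDensity_inv_density hρm hρpos hρq
  have hone : ∫⁻ y, ENNReal.ofReal (ρ y)⁻¹ ∂q = ENNReal.ofReal 1 := by
    have h : π Set.univ = 1 := measure_univ
    rw [← hπ', withDensity_apply _ MeasurableSet.univ, Measure.restrict_univ] at h
    rw [h, ENNReal.ofReal_one]
  have hlaw := iterate_bind_indepMH_dirac_singleton_real_eq_of_mode (q := q) hwm hw0' hq0 hmax zero_le_one
    hone n
  have hA' := imhAcceptMass_toReal_eq_of_forall_le (q := q) hw0' cold hmax zero_le_one hone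
  rw [hlaw, ← hA', hA]

/-! ## §3 Comparison with the one-plaquette heat bath at the cold start -/

omit [NeZero L] [SecondCountableTopology G] in
/-- **`∏_{ℓ∈T} c_{#C_ℓ} ≤ c^{#T} · M^{Σ_ℓ (#C_ℓ − 1)}`** (every `C_ℓ` non-empty; `c_{n+1} ≤ M^n c`,
`PlaquetteManyWeightConstant.integral_pow_le`). [ours] -/
theorem prod_integral_pow_card_le {w : G → ℝ} (hw : Continuous w) (hw0 : ∀ g, 0 ≤ w g) {M : ℝ}
    (hwM : ∀ g, w g ≤ M) (T : Finset (Edge d L)) (C : Edge d L → Finset (Plaquette d L))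
    (hCne : ∀ ℓ ∈ T, (C ℓ).Nonempty) :
    ∏ ℓ ∈ T, ∫ h, w h ^ (C ℓ).card ∂(haarProbability G) ≤
      (∫ h, w h ∂(haarProbability G)) ^ T.card * M ^ (∑ ℓ ∈ T, ((C ℓ).card - 1)) := by
  have hstep : ∀ ℓ ∈ T, ∫ h, w h ^ (C ℓ).card ∂(haarProbability G) ≤
      M ^ ((C ℓ).card - 1) * ∫ h, w h ∂(haarProbability G) := by
    intro ℓ hℓ
    have hcard : (C ℓ).card = ((C ℓ).card - 1) + 1 := (Nat.sub_add_cancel (Finset.card_pos.2 (hCne ℓ hℓ))).symm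
    rw [hcard, Nat.add_sub_cancel]
    exact integral_pow_le hw hw0 hwM _
  calc ∏ ℓ ∈ T, ∫ h, w h ^ (C ℓ).card ∂(haarProbability G)
      ≤ ∏ ℓ ∈ T, M ^ ((C ℓ).card - 1) * ∫ h, w h ∂(haarProbability G) :=
        Finset.prod_le_prod (fun ℓ _ => integral_nonneg fun h => pow_nonneg (hw0 h) _) hstep
    _ = (∫ h, w h ∂(haarProbability G)) ^ T.card * M ^ (∑ ℓ ∈ T, ((C ℓ).card - 1)) := by
        rw [Finset.prod_mul_distrib, Finset.prod_pow_eq_pow_sum, Finset.prod_const, mul_comm]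

omit [TopologicalSpace G] [IsTopologicalGroup G] [CompactSpace G] [SecondCountableTopology G] [MeasurableSpace G]
  [BorelSpace G] [Group G] in
/-- **For a closing assignment partitioning the plaquettes, `Σ_{ℓ∈T} #C_ℓ = #P`.** [ours] -/
theorem sum_card_closing_eq (T : Finset (Edge d L)) (C : Edge d L → Finset (Plaquette d L))
    (hdisj : ∀ ℓ ∈ T, ∀ ℓ' ∈ T, ℓ ≠ ℓ' → Disjoint (C ℓ) (C ℓ'))
    (hcover : ∀ p : Plaquette d L, ∃ ℓ ∈ T, p ∈ C ℓ) :
    ∑ ℓ ∈ T, (C ℓ).card = Fintype.card (Plaquette d L) := by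
  classical
  rw [← Finset.card_biUnion (fun ℓ hℓ ℓ' hℓ' hne => hdisj ℓ hℓ ℓ' hℓ' hne), ← Finset.card_univ]
  congr 1
  ext p
  simp only [Finset.mem_biUnion, Finset.mem_univ, iff_true]
  exact hcover p

omit [SecondCountableTopology G] in
/-- **THE ONE-PLAQUETTE HEAT BATH NEVER LEAVES THE COLD CONFIGURATION FASTER THAN THE ALL-CLOSING SAMPLER WITH AS
MANY CLOSING LINKS.**  `w` continuous, `0 < m ≤ w ≤ M`; `(T, C)` a closing assignment partitioning the plaquettes
with every `C_ℓ` non-empty and `#T = #B`.  Then the exact heat-bath cold rate `Z/(c^{#B}·M^{#Bᶜ})`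
(`AutoregressiveGaugeHeatBathColdExact`) is at most the exact all-closing cold rate `Z/∏_{ℓ∈T} c_{#C_ℓ}`; the
ratio `∏_ℓ c_{#C_ℓ}/(c^{#B} M^{#Bᶜ})` is GEN-27's `η` for the assignment induced by a total closing map.
[ours] -/
theorem heatBath_coldRate_le_allClosing {w : G → ℝ} (hw : Continuous w) {m M : ℝ} (hm0 : 0 < m)
    (hm : ∀ g, m ≤ w g) (hM : ∀ g, w g ≤ M) (B : Finset (Plaquette d L))
    (T : Finset (Edge d L)) (C : Edge d L → Finset (Plaquette d L)) (hCne : ∀ ℓ ∈ T, (C ℓ).Nonempty)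
    (hdisj : ∀ ℓ ∈ T, ∀ ℓ' ∈ T, ℓ ≠ ℓ' → Disjoint (C ℓ) (C ℓ'))
    (hcover : ∀ p : Plaquette d L, ∃ ℓ ∈ T, p ∈ C ℓ) (hTB : T.card = B.card) {Z : ℝ} (hZ : 0 ≤ Z) :
    Z / ((∫ h, w h ∂(haarProbability G)) ^ B.card * M ^ (Finset.univ \ B).card) ≤
      Z / ∏ ℓ ∈ T, ∫ h, w h ^ (C ℓ).card ∂(haarProbability G) := by
  classical
  have hw0 : ∀ g, 0 < w g := fun g => hm0.trans_le (hm g)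
  have hc : 0 < ∫ g, w g ∂(haarProbability G) := haarProbability_integral_pos_of_continuous_pos hw hw0
  have hexcess : ∑ ℓ ∈ T, ((C ℓ).card - 1) = (Finset.univ \ B).card := by
    have h1 : ∑ ℓ ∈ T, ((C ℓ).card - 1) = ∑ ℓ ∈ T, (C ℓ).card - ∑ ℓ ∈ T, 1 :=
      Finset.sum_tsub_distrib T fun ℓ hℓ => Finset.card_pos.2 (hCne ℓ hℓ)
    rw [h1, sum_card_closing_eq T C hdisj hcover, Finset.sum_const, smul_eq_mul, mul_one, hTB,
      Finset.card_sdiff_of_subset (Finset.subset_univ B), Finset.card_univ]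
  have hprod := prod_integral_pow_card_le hw (fun g => (hw0 g).le) hM T C hCne
  rw [hexcess, hTB] at hprod
  have hpos : 0 < ∏ ℓ ∈ T, ∫ h, w h ^ (C ℓ).card ∂(haarProbability G) :=
    prod_pos fun ℓ _ => haarProbability_integral_pos_of_continuous_pos (hw.pow _) fun h => pow_pos (hw0 h) _
  exact div_le_div_of_nonneg_left hZ hpos hprod

end Summit.Ventures.LatticeQCDFlow.Theory2.Autoregressive

end
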